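/-
Copyright (c) 2026. Released under the Apache 2.0 license.
-/
import Literature.NumberTheory.EllipticCurves.CongruenceNumber
import Literature.NumberTheory.EllipticCurves.CuspFormLFunction
import Literature.NumberTheory.EllipticCurves.AlgebraicModularParametrizationWithShift
import HarnessLib

/-!
# Néron differentials on `J₀(N)` at a prime with `p² ∣ N`, over `ℤ_(p)` AND over the tame extension
# `ℤ_(p)[p^{1/e}]`: the two lattices `L ⊇ L_K` in `S₂(Γ₀(N))`, Edixhoven's jump filtration, `jdeg`,
# and the tame colength of a parametrisation (Česnavičius–Neururer–Saha 2024 §5–7; Edixhoven 1992;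
# Halle–Nicaise 2016, Part II)

Topic `NumberTheory/EllipticCurves`; namespace `Literature.NumberTheory.EllipticCurves.ModularForms`.
Definition request `defn-NeronCotangentJumpFiltration` (ideation cell `bsd-idea-3`, LINE 38 of route
`TameQuarticManinParity` of the BSD summit; consumers: items stmt-BirchSwinnertonDyer-24042/24043/24044
«Manin valuation jump formula», «Manin 3-unit ⟺ tame colength bound», «(t′) III colength bound»).
The companion of the tree's `NeronFormsAt N p` / `nonempty_neronFormsAt`
(`ModularJacobianNeronDifferentials.lean`, the SEMISTABLE case `p² ∤ N`) at an ADDITIVE prime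
`p² ∣ N`, where Raynaud's `e < p − 1` is unavailable and the route reads the Manin constant on Néron
models over a tamely ramified extension. ONE hypothesis structure `TameNeronFormsAt N p e`, ONE named
fact `nonempty_tameNeronFormsAt` (statement only, cited clause by clause), real definitions of the
derived notions the LINE 38 items are phrased in (`spanK`, `jumpFiltration`, `jdeg`, `InPowK`,
`tameColength`), and unfolding lemmas. No `instance`, no notation, no `sorry`. Nothing here proves a
case of the Manin conjecture or of BSD.

## The objects (dictionary)

Fix `N ≥ 1`, a prime `p`, and `e ≥ 1` with `p ∤ e`. Put `R = ℤ_(p)`, `ϖ = ϖ_{p,e} := e^{πi/e}·p^{1/e} ∈ ℂ`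
(`tameUnif p e`; `ϖ^e = −p`), `K = ℚ(ϖ)`, `O_K = ℤ_(p)[ϖ]` — a discrete valuation ring with
uniformiser `ϖ`, residue field `𝔽_p`, `[K : ℚ] = e`, totally and TAMELY ramified at `p`
(`x^e + p` is Eisenstein). For `(p, e) = (3, 8)`: `√−3 = ϖ⁴ ∈ K`, so the level-`9` automorphism
`t : z ↦ z + 1/3` of `X₀(N)` (`9 ∣ N`) is defined over `K`, and `K ⊗ ℚ₃^{nr} = ℚ₃^{nr}(3^{1/8})` is the
field over which `J₀(9M)` acquires semi-abelian reduction (Krir 1996, Thm. 1: degree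
`p^{2v−4}(p² − 1) = 8` for `(p, v) = (3, 2)`). Let `𝒥 = 𝒥₀(N)_R` and `𝒥_K` be the Néron models of
`J₀(N)` over `R` and over `O_K`, and

  `L   := H⁰(𝒥, Ω¹)   = Cot(𝒥)   ⊂ H⁰(J₀(N)_ℚ, Ω¹) = S₂(Γ₀(N); ℚ) ⊂ S₂(Γ₀(N))`   (`lattice`),
  `L_K := H⁰(𝒥_K, Ω¹) = Cot(𝒥_K) ⊂ H⁰(J₀(N)_K, Ω¹) = S₂(Γ₀(N); K) ⊂ S₂(Γ₀(N))`   (`latticeK`),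

read inside the complex cusp forms through `H⁰(J, Ω¹) ≅ H⁰(X₀(N), Ω¹)` (pull-back along the
Albanese map of the cusp `∞`) and the `q`-expansion at `∞` (ČNS §5, (5.4.1), proof of Thm. 7.2;
Darmon–Diamond–Taylor 1995 §1.5). The fields record the PRINTED properties of `(L, L_K)`:

* `coeff_integral` — `L ⊆ S₂(Γ₀(N); ℤ_(p))`: by ČNS Prop. 6.2 (with Ex. 6.3) `H⁰(𝒥, Ω¹) ⊆
  H⁰(X₀(N)_{ℤ_(p)}, Ω) ⊆ H⁰(X₀(N)^{sm}, Ω¹)` ((5.16.1)), and "since the formal completion of `X₀(N)`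
  along `∞` is `Spf(ℤ⟦q⟧)`, the containment `ω_f ∈ H⁰(X₀(N)^∞, Ω¹)` amounts to the integrality of
  the Fourier expansion of `f` at `∞`" (§1, p. 4).
* `exists_pow_smul_mem` — `L` has full rank: `H⁰(𝒥, Ω¹) ⊗ ℚ = H⁰(J₀(N)_ℚ, Ω¹) = S₂(Γ₀(N); ℚ)`.
* `mem_of_span_newforms` — **ČNS Thm. 5.15 + Prop. 6.2 + Thm. 6.12**: every `ℤ`-linear combination
  of normalised newforms with rational `q`-expansion lies in `L`, PROVIDED `X₀(N)_{ℤ_(p)}` has rational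
  singularities (Thm. 6.12: `p ≥ 5`; or `p = 3` and `v₃(N) ≤ 2` or some prime `p' ∣ N` has
  `p' ≡ 2 mod 3`; or `p = 2` and `v₂(N) ≤ 2` or some `p' ∣ N` has `p' ≡ 3 mod 4`) — "if `X₀(N)` has
  rational singularities, then even `ω_f ∈ H⁰(𝒥₀(N), Ω¹)`" (Cor. 6.14). The rational-singularity
  condition is a HYPOTHESIS of the named fact, not a field.
* `heckeT_mem`, `fricke_mem` (and `…K`) — the Hecke correspondences `T_ℓ` (all primes `ℓ`) and the
  Fricke involution `w_N` are endomorphisms of `J₀(N)` over `ℚ` (DDT 1995 §1.5), hence extend to `𝒥`,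
  `𝒥_K` (Néron mapping property, BLR Def. 1.2/1) and preserve `L`, `L_K`.
* `latticeK_subset_spanK` — `L_K ⊆ O_K·L`: the base-change morphism `h : 𝒥 ⊗_R O_K → 𝒥_K` induces an
  INJECTIVE `Lie(h) : Lie(𝒥) ⊗ O_K → Lie(𝒥_K)` of free modules of rank `g` (Halle–Nicaise, Part II,
  §1.2 display (Lie(h)); BLR 7.2/1), dually `Cot(𝒥_K) ↪ Cot(𝒥) ⊗ O_K`.
* `pow_smul_memK` — **Edixhoven's bound** `ϖ^{e−1}·(O_K·L) ⊆ L_K`: the elementary divisors of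
  `Lie(h)` are the `K(e)`-JUMPS of `J₀(N)`, integers in `{0, …, e − 1}` (Halle–Nicaise, Part II, §1.3
  Def. "K(d)-jump" and Prop. "(c₁(G,K(d))·d, …, c_g(G,K(d))·d) = the tuple of K(d)-jumps" = Halle–
  Nicaise 2011; Edixhoven 1992: `𝒥 = (Res_{O_K/R} 𝒥_K)^{μ_e}`, the multiplicity of the jump `i/e` is
  the dimension of the `χ^i`-part of `Lie(𝒥_K ⊗ k)`). Printed over a complete `K₀` with algebraically
  closed residue field and `K(d)` its degree-`d` tame extension; our `R → O_K` becomes that after the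
  ramification-index-`1` base change `ℤ_(p) → W(𝔽̄_p)`, with which Néron models and `Lie(h)` commute
  (Halle–Nicaise, Part I preliminaries: "the formation of Néron models commutes with extensions of
  ramification index one"; BLR 7.2/1).
* `shift_memK` — for `p = 3`, `e` even, `9 ∣ N`: `t^*` (`shiftOp N h9`, `f ↦ f ∣ [1, 1/3; 0, 1]`) maps
  `L_K` into itself: `t ∈ Aut_{ℚ(ζ₃)}(X₀(N))` (Kenku–Momose; tree
  `AlgebraicModularParametrizationWithShift`), `ζ₃ ∈ K`, Néron mapping property over `O_K`.
* For every globally minimal elliptic `W/ℚ` with a LATTICE-OPTIMAL datum `D` at level `N`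
  (`Λ_W = c·Λ_f`: `W` is the optimal curve of `f = D.f`, `c = D.maninConstant` its Manin constant
  with respect to the Néron differential `ω_W`, `π : J₀(N) → W` the optimal quotient, `π^∨` its dual,
  `π ∘ π^∨ = [deg φ]` — ČNS Lemma 7.1; `π^* ω_W = c·f`):
  - `pullback_integral` (over `R`) — `(π^∨)^*(L) ⊆ H⁰(ℰ_{ℤ_(p)}, Ω¹) = ℤ_(p) ω_W` (Néron functoriality
    of `π^∨`; ČNS proof of Thm. 7.2, display (7.2.1) ff.), where on `S₂(Γ₀(N))`
    `(π^∨)^* g = (deg φ/c)(⟨f, g⟩/⟨f, f⟩)·ω_W` (Abbes–Ullmo 1996 Lemme 3.1: `(π^∨)^*` kills the Petersson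
    orthogonal of `f`): the numbers `deg φ·⟨f, g⟩/(c⟨f, f⟩)`, `g ∈ L`, are `p`-integral. SAME SHAPE
    as `NeronFormsAt.pullback_integral`; with `g = f ∈ L` it gives `v_p(c) ≤ v_p(deg φ)` (ČNS
    Thm. 1.2 / 7.2 at `p`) — see the HONESTY audit.
  - `tame_smul_memK`, `tame_pullback_integralK` (over `O_K`) — under `HasTameGoodModel p e W a`
    (`W` acquires GOOD reduction over `K` through a change of variables `(u, r, s, t) = (ϖ^a, r, s, t)`
    with `r, s, t ∈ O_K`; then the Néron model `ℰ_K` of `W_K` is that good model and its Néron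
    differential is `ω_{W,K} = ϖ^a·ω_W`, Silverman AEC III §1 Table 3.1 `u⁻¹ω' = ω`, VII.1.3 (d)):
    `π^* ω_{W,K} = ϖ^a c f ∈ L_K` and `(π^∨)^*(L_K) ⊆ O_K ω_{W,K} = ϖ^a O_K ω_W` (Néron functoriality over
    `O_K`; BLR 1.2/1, 7.2/1). For the tame quartic class (t′) at `p = 3`, `e = 8`: `a = e·v₃(Δ_min)/12`
    is `2` for Kodaira III (`v₃(Δ_min) = 3`) and `6` for III* (`v₃(Δ_min) = 9`) (Edixhoven 1991 §4).

DERIVED NOTIONS (real definitions over the structure; they are the quantities of LINE 38):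
* `spanK` — `O_K·L = ⊕_{i<e} ϖ^i L`;  `jumpFiltration j = F_j L := L ∩ ϖ^{−j} L_K` (`j = 0, …, e−1`),
  Edixhoven's increasing filtration read on `Cot`: `F_{e−1} L = L` (`jumpFiltration_pred_eq`),
  `dim_{𝔽_p} gr_j(L/pL)` = multiplicity of the jump `j/e`;
* `jdeg` — `jdeg(g) := min {j : ϖ^j g ∈ L_K}` for `g ∈ L` (`≤ e − 1`);
* `InPowK x m` — `x ∈ ϖ^m L_K`;  `tameColength D a := sup {m : ϖ^a c f ∈ ϖ^m L_K}` — at the true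
  lattices and for `a` the Néron exponent this is `col_K(D) = length_{O_K} coker(Lie 𝒥_K → Lie ℰ_K)`
  (the `K`-inseparability colength: the image of `Lie 𝒥_K` in `Lie ℰ_K ≅ Hom(O_K ω_{W,K}, O_K)` is the
  ideal generated by the coordinates of `π^*ω_{W,K}` in a basis of `L_K = Cot(𝒥_K)`), `= 0` iff
  `𝒥_K → ℰ_K` is smooth; likewise `v_p(c) = length_R coker(Lie 𝒥 → Lie ℰ)` because `f` is primitive
  in `L` (ČNS Rem. 5.16). The memo's «formula (B)» `e·v_p(c) = col_K + jdeg(f) − a` and its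
  corollaries are THEOREMS about these definitions (companion `…TameProofs`); nothing of LINE 38's
  crux («col_K(III) ≤ 2») is asserted here.

## HONESTY / faithfulness audit (read before using)

1. `TameNeronFormsAt` is a HYPOTHESIS STRUCTURE: `lattice`, `latticeK` are data, not definitions;
   the docstrings say which modules they stand for; nothing in Lean ties them to Néron models (the
   tree has `IsNeronModel`/`NeronKernelData` in scheme language but no cotangent functor along the
   unit section over a base and `J₀(N)` only as a posited package — NEEDS-X (X1)–(X2) of
   `ModularJacobianNeronDifferentials`). The named fact is exactly as strong as the conjunction of the
   fields AT THE TRUE LATTICES, each a printed statement or a special case of one.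
2. NOT JUNK-INHABITABLE in the cheap way: `mem_of_span_newforms` + `pullback_integral` imply, for
   every lattice-optimal datum, `v_p(c) ≤ v_p(deg φ)` — ČNS Thm. 1.2 at `p` (the tree's cite-only
   fact `cesnaviciusNeururerSaha_thm_1_2`, row «0 otherwise»); and `tame_pullback_integralK` +
   `tame_smul_memK` + `pow_smul_memK` tie `L_K` to the arithmetic of `W` over `K`. Conversely NO field
   pins `L_K` between `ϖ^{e−1} O_K L` and `O_K L` beyond these clauses: at `e ≥ p − 1` no saturation /
   Lie-surjectivity statement is in print (that is the point of LINE 38), so `jdeg`, `tameColength`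
   and the multiplicities of `jumpFiltration` are DICTIONARY quantities — correct at the true
   lattices, unconstrained otherwise. A consumer's theorem `∀ Λ : TameNeronFormsAt N 3 8, …` is a
   theorem about the Néron lattices exactly to the extent its proof uses only the fields.
3. Net ledger effect: `+1` named fact (`nonempty_tameNeronFormsAt`); no fact discharged; no summit
   statement touched; BSD is not advanced by this file.
4. NOT HERE: the `μ_e`-semilinear (Galois-descent) structure of `L_K` over `W(𝔽̄_p)[ϖ]` and
   Edixhoven's eigenbasis `L_K = ⊕ O_K ϖ^{t_ℓ} e_ℓ` (a consequence of the two inclusions plus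
   descent; `K = ℚ(ϖ)` is not Galois over `ℚ`); semi-abelian reduction of `J₀(N)_K` (Krir 1996; it
   makes `L_K` insensitive to further tame extension but is not used by any field); Atkin–Lehner
   `w_Q` for `Q ∥ N` other than `w_N`; the Néron exponent of `W` over `K` when `W_K` is not of good
   reduction (`TODO(general form)`: `a = (e·v_p(Δ_min) − v_ϖ(Δ_{min,K}))/12`); Edixhoven's kernel
   `G` (that is `NeronKernelData`, scheme level) and its link `col_K = 0 ⇒ G = 0`.

## References

* [CesnaviciusNeururerSaha2023] K. Česnavičius, M. Neururer, A. Saha, *The Manin constant and the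
  modular degree*, JEMS 26 (2024) 573–637 = arXiv:1911.09446v3: §1 p. 4; Thm. 5.15, Rem. 5.16 (p. 40);
  Prop. 6.2 (p. 41), Ex. 6.3, Lemma 6.5 (p. 42), Thm. 6.12, Cor. 6.14 (p. 46); Lemma 7.1, Thm. 7.2 and
  its proof (pp. 46–47) (arXiv v3 pagination).
* [HalleNicaise2016] L. H. Halle, J. Nicaise, *Néron Models and Base Change*, LNM 2156 (2016) =
  arXiv:1209.5556: Part II, chapter "The base change conductor and Edixhoven's filtration", §1.1
  (elementary divisors of a morphism of free modules), §1.2 (`Lie(h)`, `c_i(G,K')`), §1.3 (jumps,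
  Edixhoven's filtration; Prop. = [Halle–Nicaise, Adv. Math. 227 (2011)] on `c_i(G,K(d))·d =` jumps).
* [Edixhoven1992NeronModelsTame] B. Edixhoven, *Néron models and tame ramification*, Compositio
  Math. 81 (1992) 291–306 (cited through Halle–Nicaise; not held).
* [Krir1996] M. Krir, AIF 46 (1996), Thm. 1 (p. 284).
* [BoschLutkebohmertRaynaud1990] *Néron Models*, Def. 1.2/1, 7.2/1.
* [AbbesUllmo1996] A. Abbes, E. Ullmo, Compositio 103 (1996), §3 Lemme 3.1 (p. 275).
* [SilvermanAEC2009] J. H. Silverman, AEC, III §1 Table 3.1, VII.1 Prop. 1.3 (d).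
* [EdixhovenManin1991] B. Edixhoven, *On the Manin constants …* (1991), §1, §4.
* [DarmonDiamondTaylor1995] §1.5 (models of `X₀(N)`, `J₀(N)`, Hecke correspondences over `ℚ`).
-/

noncomputable section

open scoped MatrixGroups ModularForm

open CongruenceSubgroup UpperHalfPlane

namespace Literature.NumberTheory.EllipticCurves.ModularForms

/-! ### The tame uniformiser `ϖ = e^{πi/e} p^{1/e}` and the rings `ℤ_(p) ⊂ ℤ_(p)[ϖ] ⊂ ℂ` -/

section Scalars

/-- **The tame uniformiser** `ϖ_{p,e} := e^{πi/e}·p^{1/e} ∈ ℂ`: a root of `x^e + p` (Eisenstein at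
`p`), generating the totally, tamely (when `p ∤ e`) ramified extension `K = ℚ(ϖ)` of degree `e` with
valuation ring `ℤ_(p)[ϖ]` at `p`; `ϖ^e = −p` (`tameUnif_pow`). The sign is chosen so that for `e` even
`√(−p) = ϖ^{e/2} ∈ K` (at `p = 3`: `ζ₃ ∈ K`). [folklore] -/
def tameUnif (p e : ℕ) : ℂ :=
  Complex.exp (Real.pi * Complex.I / e) * (((p : ℝ) ^ ((e : ℝ)⁻¹) : ℝ) : ℂ)

/-- `ϖ^e = −p`: `ϖ` is a root of the Eisenstein polynomial `x^e + p`.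
[cite: SerreLocalFields1979, Ch. I §6, Prop. 17] -/
theorem tameUnif_pow {p e : ℕ} (he : e ≠ 0) : tameUnif p e ^ e = -p := by
  unfold tameUnif
  rw [mul_pow, ← Complex.exp_nat_mul, ← Complex.ofReal_pow,
    Real.rpow_inv_natCast_pow (Nat.cast_nonneg p) he]
  have : (e : ℂ) * (Real.pi * Complex.I / e) = Real.pi * Complex.I := by
    field_simp
  rw [this, Complex.exp_pi_mul_I]
  push_cast
  ring

/-- `ϖ ≠ 0` (for `p ≠ 0`). [cite: SerreLocalFields1979, Ch. I §6, Prop. 17] -/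
theorem tameUnif_ne_zero {p : ℕ} (e : ℕ) (hp : p ≠ 0) : tameUnif p e ≠ 0 := by
  unfold tameUnif
  refine mul_ne_zero (Complex.exp_ne_zero _) ?_
  rw [Complex.ofReal_ne_zero]
  exact (Real.rpow_pos_of_pos (Nat.cast_pos.mpr (Nat.pos_of_ne_zero hp)) _).ne'

/-- `x ∈ ℤ_(p) ⊂ ℂ`: `x` is a rational number with non-negative `p`-adic valuation (the currency
`∃ t : ℚ, 0 ≤ padicValRat p t ∧ ↑t = x` of `NeronFormsAt`). [cite: SerreLocalFields1979, Ch. I §1 (the discrete valuation ring `ℤ_(p)`)] -/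
def IsPIntegral (p : ℕ) (x : ℂ) : Prop :=
  ∃ t : ℚ, 0 ≤ padicValRat p t ∧ (t : ℂ) = x

/-- `x ∈ O_K = ℤ_(p)[ϖ] ⊂ ℂ`, in the normal form of the free `ℤ_(p)`-module `⊕_{i<e} ℤ_(p) ϖ^i`
(`x^e + p` is the minimal polynomial of `ϖ`): `x = ∑_{i<e} t_i ϖ^i` with `t_i ∈ ℤ_(p)`. For `p ∤ e`
this is the valuation ring of `K = ℚ(ϖ)` at the unique prime above `p` (Eisenstein criterion);
`ϖ^a·O_K` is its ideal of elements of valuation `≥ a` (Serre: for an Eisenstein polynomial the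
extension is totally ramified, `ϖ` is a uniformiser and `O_K = ℤ_(p)[ϖ]`).
[cite: SerreLocalFields1979, Ch. I §6, Prop. 17–18] -/
def IsTameIntegral (p e : ℕ) (x : ℂ) : Prop :=
  ∃ t : Fin e → ℚ, (∀ i, 0 ≤ padicValRat p (t i)) ∧ x = ∑ i : Fin e, (t i : ℂ) * tameUnif p e ^ (i : ℕ)

/-- `0 ∈ ℤ_(p)`. [cite: SerreLocalFields1979, Ch. I §1] -/
theorem isPIntegral_zero (p : ℕ) : IsPIntegral p 0 :=
  ⟨0, by simp, by simp⟩

/-- Integers are `p`-integral: `ℤ ⊆ ℤ_(p)`. [cite: SerreLocalFields1979, Ch. I §1] -/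
theorem isPIntegral_intCast (p : ℕ) (z : ℤ) : IsPIntegral p z :=
  ⟨z, by simp, by simp⟩

/-- `0 ∈ O_K`. [cite: SerreLocalFields1979, Ch. I §6, Prop. 17–18] -/
theorem isTameIntegral_zero (p e : ℕ) : IsTameIntegral p e 0 :=
  ⟨0, fun _ ↦ by simp, by simp⟩

end Scalars

/-! ### Good reduction of `W` over `K = ℚ(ϖ)` with Néron exponent `a` -/

section GoodModel

/-- **`W` acquires good reduction over `K = ℚ(ϖ)`, with Néron exponent `a`**: there are
`r, s, t ∈ O_K` such that the change of variables `(u, r, s, t) = (ϖ^a, r, s, t)` (Silverman AEC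
III §1: `x = u²x' + r`, `y = u³y' + u²sx' + t`, `u⁻¹ω' = ω`, `Δ' = u^{−12}Δ`) carries `W ⊗ ℂ` to a
Weierstrass equation with coefficients in `O_K` and discriminant a UNIT of `O_K`. Then that equation
is a minimal (indeed good) model of `W_K` at the prime `(ϖ)`, the Néron model `ℰ_K` of `W_K` is the
corresponding abelian scheme, and its Néron differential is `ω_{W,K} = ϖ^a·ω_W` (AEC VII.1.3 (d):
for integral `W` the change to a minimal equation has `u, r, s, t` integral). Necessarily
`12a = e·v_p(Δ_W)` when `W` is `p`-minimal. For the tame quartic class (t′) at `p = 3` with `e = 8`: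
`a = 2` (Kodaira III, `v₃(Δ_min) = 3`), `a = 6` (III*, `v₃(Δ_min) = 9`).
[cite: SilvermanAEC2009, III §1 Table 3.1; VII.1 Prop. 1.3 (d), Remark 1.1] -/
def HasTameGoodModel (p e : ℕ) (W : WeierstrassCurve ℚ) (a : ℕ) : Prop :=
  ∃ (hϖ : tameUnif p e ≠ 0) (r s t : ℂ),
    IsTameIntegral p e r ∧ IsTameIntegral p e s ∧ IsTameIntegral p e t ∧
    let W' : WeierstrassCurve ℂ :=
      (⟨Units.mk0 (tameUnif p e ^ a) (pow_ne_zero a hϖ), r, s, t⟩ :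
        WeierstrassCurve.VariableChange ℂ) • W.baseChange ℂ
    IsTameIntegral p e W'.a₁ ∧ IsTameIntegral p e W'.a₂ ∧ IsTameIntegral p e W'.a₃ ∧
      IsTameIntegral p e W'.a₄ ∧ IsTameIntegral p e W'.a₆ ∧
      ∃ y : ℂ, IsTameIntegral p e y ∧ W'.Δ * y = 1

end GoodModel

/-! ### The structure -/

/-- **The Néron lattices `L = H⁰(𝒥₀(N)_{ℤ_(p)}, Ω¹) ⊇ L_K = H⁰(𝒥₀(N)_{ℤ_(p)[ϖ]}, Ω¹)` inside
`S₂(Γ₀(N))` and their printed properties** at a prime `p` (intended: `p² ∣ N`) and a tame exponent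
`e` (`p ∤ e`; intended `(p, e) = (3, 8)`, `v₃(N) = 2`) — hypothesis structure; see the module
docstring for the dictionary, the provenance of every field and the HONESTY audit. `lattice` stands
for the cotangent space along the zero section of the Néron model of `J₀(N)` over `ℤ_(p)`, `latticeK`
for that of the Néron model over `ℤ_(p)[ϖ]`, `ϖ = tameUnif p e`, both read in `S₂(Γ₀(N))` through
`H⁰(J, Ω¹) ≅ H⁰(X₀(N), Ω¹)` and the `q`-expansion at `∞`. The `W`-fields quantify over globally
minimal `W/ℚ` with a lattice-optimal datum `D` (`Λ_W = c Λ_f`).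
[cite: CesnaviciusNeururerSaha2023, Thm. 5.15, Rem. 5.16 (p. 40); Prop. 6.2 (p. 41); Thm. 6.12, Cor. 6.14 (p. 46); Lemma 7.1, Thm. 7.2 and proof (pp. 46–47)]
[cite: HalleNicaise2016, Part II, ch. "The base change conductor and Edixhoven's filtration", §1.2–§1.3]
[cite: BoschLutkebohmertRaynaud1990, Def. 1.2/1, 7.2/1] -/
structure TameNeronFormsAt (N : ℕ) [NeZero N] (p e : ℕ) where
  /-- `L = H⁰(𝒥₀(N)_{ℤ_(p)}, Ω¹) ⊂ S₂(Γ₀(N))` (as a `ℤ`-submodule of the complex cusp forms). -/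
  lattice : Submodule ℤ (CuspForm (Gamma0 N) 2)
  /-- `L_K = H⁰(𝒥₀(N)_{O_K}, Ω¹) ⊂ S₂(Γ₀(N))`, `O_K = ℤ_(p)[ϖ]` (as a `ℤ`-submodule). -/
  latticeK : Submodule ℤ (CuspForm (Gamma0 N) 2)
  /-- `L` is a `ℤ_(p)`-module: `n⁻¹ L ⊆ L` for `p ∤ n`. [folklore] -/
  inv_smul_mem : ∀ h ∈ lattice, ∀ n : ℕ, ¬ p ∣ n → ((n : ℂ)⁻¹) • h ∈ lattice
  /-- `L_K` is a `ℤ_(p)`-module. [folklore] -/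
  inv_smul_memK : ∀ h ∈ latticeK, ∀ n : ℕ, ¬ p ∣ n → ((n : ℂ)⁻¹) • h ∈ latticeK
  /-- `L_K` is an `O_K = ℤ_(p)[ϖ]`-module: `ϖ L_K ⊆ L_K`. [folklore] -/
  tameUnif_smul_memK : ∀ h ∈ latticeK, tameUnif p e • h ∈ latticeK
  /-- `L ⊆ S₂(Γ₀(N); ℤ_(p))`: the `q`-expansion at `∞` of a Néron differential is `p`-integral
  (ČNS Prop. 6.2/Ex. 6.3: `H⁰(𝒥, Ω¹) ⊆ H⁰(X₀(N)_{ℤ_(p)}, Ω)`; (5.16.1): `⊆ H⁰(X₀(N)^{sm}, Ω¹)`; §1 p. 4: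
  membership in `H⁰(X₀(N)^∞, Ω¹)` "amounts to the integrality of the Fourier expansion at `∞`"). -/
  coeff_integral : ∀ h ∈ lattice, ∀ n : ℕ, IsPIntegral p (cuspCoeff h n)
  /-- `L` has full rank in `S₂(Γ₀(N); ℚ)`: every form with integral coefficients has a `p`-power
  multiple in `L` (`H⁰(𝒥, Ω¹) ⊗ ℚ = H⁰(J₀(N)_ℚ, Ω¹)`, ČNS (6.2.2); DDT 1995 §1.5). -/
  exists_pow_smul_mem : ∀ g ∈ integralCuspForms0 N 2, ∃ k : ℕ, ((p : ℂ) ^ k) • g ∈ lattice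
  /-- **ČNS Thm. 5.15 with Prop. 6.2 and Thm. 6.12** (under the rational-singularity hypothesis of
  the named fact): a `ℤ`-linear combination of normalised newforms on `Γ₀(N)` whose `q`-expansion is
  rational lies in `H⁰(X₀(N)_{ℤ_(p)}, Ω) = H⁰(𝒥₀(N)_{ℤ_(p)}, Ω¹) = L` (Cor. 6.14). -/
  mem_of_span_newforms : ∀ g ∈ Submodule.span ℤ (newforms0 N 2),
    (∀ n : ℕ, ∃ q : ℚ, (q : ℂ) = cuspCoeff g n) → g ∈ lattice
  /-- `T_ℓ L ⊆ L` for every prime `ℓ` (`U_ℓ` when `ℓ ∣ N`): the Hecke correspondences are defined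
  over `ℚ` (DDT 1995 §1.5) and extend to the Néron model (BLR Def. 1.2/1). -/
  heckeT_mem : ∀ (ℓ : ℕ) [NeZero ℓ], ℓ.Prime → ∀ h ∈ lattice, heckeT (Gamma0 N) 2 ℓ h ∈ lattice
  /-- `T_ℓ L_K ⊆ L_K` (same, over `O_K`). [cite: BoschLutkebohmertRaynaud1990, Def. 1.2/1] -/
  heckeT_memK : ∀ (ℓ : ℕ) [NeZero ℓ], ℓ.Prime → ∀ h ∈ latticeK, heckeT (Gamma0 N) 2 ℓ h ∈ latticeK
  /-- `w_N L ⊆ L`: the Fricke involution is defined over `ℚ` and extends to the Néron model.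
  [cite: BoschLutkebohmertRaynaud1990, Def. 1.2/1] -/
  fricke_mem : ∀ h ∈ lattice, frickeInvolution N 2 h ∈ lattice
  /-- `w_N L_K ⊆ L_K`. [cite: BoschLutkebohmertRaynaud1990, Def. 1.2/1] -/
  fricke_memK : ∀ h ∈ latticeK, frickeInvolution N 2 h ∈ latticeK
  /-- `L_K ⊆ O_K·L = ⊕_{i<e} ϖ^i L`: the base-change morphism `𝒥 ⊗ O_K → 𝒥_K` is injective on Lie
  algebras (Halle–Nicaise II §1.2; BLR 7.2/1), dually `Cot(𝒥_K) ⊆ Cot(𝒥) ⊗ O_K`. -/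
  latticeK_subset_spanK : ∀ h ∈ latticeK, ∃ l : Fin e → CuspForm (Gamma0 N) 2,
    (∀ i, l i ∈ lattice) ∧ h = ∑ i : Fin e, tameUnif p e ^ (i : ℕ) • l i
  /-- **Edixhoven's bound** `ϖ^{e−1} L ⊆ L_K`: the elementary divisors of `Lie(𝒥) ⊗ O_K → Lie(𝒥_K)`
  are the `K(e)`-jumps `∈ {0, …, e−1}` (Halle–Nicaise II §1.3, Def. of `K(d)`-jumps and the Prop.
  `c_i(G, K(d))·d =` jumps; Edixhoven 1992). -/
  pow_smul_memK : ∀ l ∈ lattice, tameUnif p e ^ (e - 1) • l ∈ latticeK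
  /-- For `p = 3`, `e` even (`ζ₃ = (−1 + ϖ^{e/2})/2 ∈ K`) and `9 ∣ N`: the shift `t^*`, `f ↦ f∣t`,
  `t = [1, 1/3; 0, 1] ∈ Aut_{ℚ(ζ₃)}(X₀(N))`, preserves `L_K` (Néron mapping property over `O_K`).
  [cite: BoschLutkebohmertRaynaud1990, Def. 1.2/1] -/
  shift_memK : p = 3 → Even e → ∀ (h9 : 3 ^ 2 ∣ N), ∀ h ∈ latticeK, shiftOp N h9 h ∈ latticeK
  /-- `(π^∨)^*(L) ⊆ H⁰(ℰ_{ℤ_(p)}, Ω¹) = ℤ_(p) ω_W` for the dual `π^∨ : W → J₀(N)` of the optimal quotient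
  (Néron functoriality; ČNS proof of Thm. 7.2, `π ∘ π^∨ = deg φ` Lemma 7.1, `π^*ω_W = c f`), with
  `(π^∨)^* g = (deg φ/c)(⟨f, g⟩/⟨f, f⟩) ω_W` (Abbes–Ullmo Lemme 3.1): the numbers
  `deg φ·⟨f, g⟩/(c ⟨f, f⟩)`, `g ∈ L`, are `p`-integral. [cite: AbbesUllmo1996, Lemme 3.1 (p. 275)] -/
  pullback_integral : ∀ (W : WeierstrassCurve ℚ) [W.IsElliptic] [W.IsGloballyMinimal]
    (D : ModularParametrizationData W N),
    (∀ z ∈ D.L.lattice, ∃ w ∈ periodLattice D.f, z = D.c * w) →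
    ∀ g ∈ lattice, ∃ t : ℚ, 0 ≤ padicValRat p t ∧
      (D.modularDegree : ℂ) * peterssonProduct (Gamma0 N) 2 D.f g =
        (t : ℂ) * (D.maninConstant : ℂ) * peterssonProduct (Gamma0 N) 2 D.f D.f
  /-- Over `O_K`, if `W` acquires good reduction over `K` with Néron exponent `a`
  (`ω_{W,K} = ϖ^a ω_W`): `π^* ω_{W,K} = ϖ^a·c·f ∈ Cot(𝒥_K) = L_K` (Néron functoriality of `π` over
  `O_K`). [cite: BoschLutkebohmertRaynaud1990, Def. 1.2/1] -/
  tame_smul_memK : ∀ (W : WeierstrassCurve ℚ) [W.IsElliptic] [W.IsGloballyMinimal]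
    (D : ModularParametrizationData W N),
    (∀ z ∈ D.L.lattice, ∃ w ∈ periodLattice D.f, z = D.c * w) →
    ∀ a : ℕ, HasTameGoodModel p e W a →
      (tameUnif p e ^ a * (D.maninConstant : ℂ)) • D.f ∈ latticeK
  /-- Over `O_K`, same hypothesis: `(π^∨)^*(L_K) ⊆ Cot(ℰ_K) = O_K ω_{W,K} = ϖ^a O_K ω_W`, i.e. the numbers
  `deg φ·⟨f, g⟩/(c⟨f, f⟩)`, `g ∈ L_K`, lie in `ϖ^a O_K`. [cite: BoschLutkebohmertRaynaud1990, Def. 1.2/1]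
  [cite: AbbesUllmo1996, Lemme 3.1 (p. 275)] -/
  tame_pullback_integralK : ∀ (W : WeierstrassCurve ℚ) [W.IsElliptic] [W.IsGloballyMinimal]
    (D : ModularParametrizationData W N),
    (∀ z ∈ D.L.lattice, ∃ w ∈ periodLattice D.f, z = D.c * w) →
    ∀ a : ℕ, HasTameGoodModel p e W a →
    ∀ g ∈ latticeK, ∃ x : ℂ, IsTameIntegral p e x ∧
      (D.modularDegree : ℂ) * peterssonProduct (Gamma0 N) 2 D.f g =
        tameUnif p e ^ a * x * (D.maninConstant : ℂ) * peterssonProduct (Gamma0 N) 2 D.f D.f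

/-! ### The named fact -/

/-- **Existence of the tame Néron lattices with their printed properties** (named fact, statement
only; a construction statement in the pattern of `nonempty_neronFormsAt`). For every `N ≥ 1`, every
prime `p`, every `e ≥ 1` with `p ∤ e`, such that `X₀(N)_{ℤ_(p)}` has rational singularities by ČNS
Thm. 6.12 — `p ≥ 5`; or `p = 3` and (`v₃(N) ≤ 2` or some prime `p' ∣ N` has `p' ≡ 2 mod 3`); or
`p = 2` and (`v₂(N) ≤ 2` or some prime `p' ∣ N` has `p' ≡ 3 mod 4`) — the lattices
`L = H⁰(𝒥₀(N)_{ℤ_(p)}, Ω¹)` and `L_K = H⁰(𝒥₀(N)_{ℤ_(p)[ϖ]}, Ω¹)`, `ϖ = e^{πi/e}p^{1/e}`, read in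
`S₂(Γ₀(N))`, have the properties listed in `TameNeronFormsAt N p e`: `p`-integral `q`-expansions and
full rank (ČNS Prop. 6.2, (5.16.1), §1), `ℤ`-combinations of normalised newforms with rational
expansion lie in `L` (ČNS Thm. 5.15, Prop. 6.2, Thm. 6.12, Cor. 6.14), Hecke/Fricke/shift stability
(Néron mapping property), `ϖ^{e−1} O_K L ⊆ L_K ⊆ O_K L` (BLR 7.2/1; Edixhoven 1992 = Halle–Nicaise II
§1.2–1.3), and Néron functoriality of the optimal quotient and its dual over `ℤ_(p)` and over `O_K`
(ČNS Lemma 7.1, Thm. 7.2 and proof; Abbes–Ullmo Lemme 3.1; Silverman VII.1.3 (d)). The case the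
route TameQuarticManinParity uses is `(p, e) = (3, 8)`, `v₃(N) = 2` (`nonempty_tameNeronFormsAt_three`;
Krir 1996 Thm. 1: `J₀(N)` is semi-abelian over `ℚ₃^{nr}(3^{1/8})`). See the module docstring
(HONESTY audit) for what this does and does not assert.
[cite: CesnaviciusNeururerSaha2023, Thm. 5.15, Rem. 5.16 (p. 40); Prop. 6.2 (p. 41); Thm. 6.12, Cor. 6.14 (p. 46); Lemma 7.1, Thm. 7.2 (pp. 46–47)]
[cite: HalleNicaise2016, Part II, ch. "The base change conductor and Edixhoven's filtration", §1.1–§1.3]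
[cite: Edixhoven1992NeronModelsTame, §4–§5 (Néron model as fixed points of the Weil restriction; filtration, jumps < 1), cited through HalleNicaise2016 Part II §1.3]
[cite: BoschLutkebohmertRaynaud1990, Def. 1.2/1, 7.2/1] [cite: AbbesUllmo1996, Lemme 3.1 (p. 275)]
[cite: Krir1996, Thm. 1 (p. 284)] -/
def nonempty_tameNeronFormsAt : Prop :=
  ∀ (N : ℕ) [NeZero N] (p e : ℕ), p.Prime → 0 < e → ¬ p ∣ e →
    (5 ≤ p ∨
      (p = 3 ∧ (padicValNat 3 N ≤ 2 ∨ ∃ p' : ℕ, p'.Prime ∧ p' ∣ N ∧ p' % 3 = 2)) ∨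
      (p = 2 ∧ (padicValNat 2 N ≤ 2 ∨ ∃ p' : ℕ, p'.Prime ∧ p' ∣ N ∧ p' % 4 = 3))) →
    Nonempty (TameNeronFormsAt N p e)

/-- The case of the route TameQuarticManinParity: `p = 3`, `e = 8`, `v₃(N) = 2` (`N = 9M`, `3 ∤ M`) —
a specialisation of `nonempty_tameNeronFormsAt` (proved from it). [cite: CesnaviciusNeururerSaha2023, Thm. 6.12 (b) (p. 46)]
[cite: Krir1996, Thm. 1 (p. 284)] -/
theorem nonempty_tameNeronFormsAt_three (h : nonempty_tameNeronFormsAt) (N : ℕ) [NeZero N]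
    (hN : padicValNat 3 N = 2) : Nonempty (TameNeronFormsAt N 3 8) :=
  h N 3 8 Nat.prime_three (by norm_num) (by norm_num) (Or.inr (Or.inl ⟨rfl, Or.inl hN.le⟩))

/-! ### Derived notions: `O_K·L`, the jump filtration, `jdeg`, the tame colength -/

namespace TameNeronFormsAt

variable {N : ℕ} [NeZero N] {p e : ℕ} (Λ : TameNeronFormsAt N p e)

/-- `L_K` is closed under `ϖ^m` (`O_K`-module structure of `H⁰(𝒥_K, Ω¹)`).
[cite: HalleNicaise2016, Part II §1.2] -/
theorem tameUnif_pow_smul_memK {h : CuspForm (Gamma0 N) 2} (hh : h ∈ Λ.latticeK) (m : ℕ) :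
    tameUnif p e ^ m • h ∈ Λ.latticeK := by
  induction m with
  | zero => simpa using hh
  | succ m ih =>
    rw [pow_succ', mul_smul]
    exact Λ.tameUnif_smul_memK _ ih

/-- The newform of a modular parametrisation datum lies in `L`: `D.f` is a normalised newform
(`IsNewformOf`) with integer coefficients `aₙ(W)`, so `mem_of_span_newforms` applies — ČNS Cor. 6.14
"`ω_f ∈ H⁰(𝒥₀(N), Ω¹)`" at `p`. [cite: CesnaviciusNeururerSaha2023, Cor. 6.14 (p. 46)] -/
theorem f_mem {W : WeierstrassCurve ℚ} (D : ModularParametrizationData W N) : D.f ∈ Λ.lattice := by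
  refine Λ.mem_of_span_newforms D.f (Submodule.subset_span D.isNewformOf.1) fun n ↦ ?_
  exact ⟨W.LFunction n, by rw [D.isNewformOf.2 n]; push_cast; rfl⟩

/-- `L ⊆ L_K`'s ambient: every element of `L` has its `ϖ^{e−1}`-multiple in `L_K`, so
`∃ j, ϖ^j g ∈ L_K` — the witness used to define `jdeg`. [cite: HalleNicaise2016, Part II §1.3] -/
theorem exists_pow_smul_memK {g : CuspForm (Gamma0 N) 2} (hg : g ∈ Λ.lattice) :
    ∃ j : ℕ, tameUnif p e ^ j • g ∈ Λ.latticeK :=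
  ⟨e - 1, Λ.pow_smul_memK g hg⟩

/-- **`O_K·L = ⊕_{i<e} ϖ^i L`**, the `O_K`-span of `L` inside `S₂(Γ₀(N))` (`= Cot(𝒥) ⊗_{ℤ_(p)} O_K`,
the target of the dual base-change map `Cot(𝒥_K) ↪ Cot(𝒥) ⊗ O_K`), as a `ℤ`-submodule: the sums
`∑_{i<e} ϖ^i l_i` with `l_i ∈ L`. [cite: HalleNicaise2016, Part II §1.2] -/
def spanK : Submodule ℤ (CuspForm (Gamma0 N) 2) where
  carrier := {h | ∃ l : Fin e → CuspForm (Gamma0 N) 2,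
    (∀ i, l i ∈ Λ.lattice) ∧ h = ∑ i : Fin e, tameUnif p e ^ (i : ℕ) • l i}
  zero_mem' := ⟨0, fun _ ↦ Λ.lattice.zero_mem, by simp⟩
  add_mem' := by
    rintro _ _ ⟨l, hl, rfl⟩ ⟨l', hl', rfl⟩
    refine ⟨l + l', fun i ↦ Λ.lattice.add_mem (hl i) (hl' i), ?_⟩
    rw [← Finset.sum_add_distrib]
    exact Finset.sum_congr rfl fun i _ ↦ by rw [Pi.add_apply, smul_add]
  smul_mem' := by
    rintro z _ ⟨l, hl, rfl⟩
    refine ⟨z • l, fun i ↦ Λ.lattice.smul_mem z (hl i), ?_⟩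
    rw [Finset.smul_sum]
    exact Finset.sum_congr rfl fun i _ ↦ by rw [Pi.smul_apply, smul_comm]

/-- Membership in `O_K·L` (unfolding). [cite: HalleNicaise2016, Part II §1.2] -/
theorem mem_spanK {h : CuspForm (Gamma0 N) 2} :
    h ∈ Λ.spanK ↔ ∃ l : Fin e → CuspForm (Gamma0 N) 2,
      (∀ i, l i ∈ Λ.lattice) ∧ h = ∑ i : Fin e, tameUnif p e ^ (i : ℕ) • l i :=
  Iff.rfl

/-- `L_K ⊆ O_K·L` (the field `latticeK_subset_spanK`, as an inclusion of submodules).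
[cite: HalleNicaise2016, Part II §1.2] -/
theorem latticeK_le_spanK : Λ.latticeK ≤ Λ.spanK :=
  fun h hh ↦ Λ.latticeK_subset_spanK h hh

/-- `L ⊆ O_K·L` (take `l_0 = h`, `l_i = 0` for `i ≠ 0`; needs `e ≠ 0`): the base change
`Cot(𝒥) → Cot(𝒥) ⊗ O_K`. [cite: HalleNicaise2016, Part II §1.2] -/
theorem lattice_le_spanK (he : e ≠ 0) : Λ.lattice ≤ Λ.spanK := by
  intro h hh
  haveI : NeZero e := ⟨he⟩
  refine ⟨Pi.single 0 h, fun i ↦ ?_, ?_⟩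
  · by_cases hi : i = 0
    · subst hi; simpa using hh
    · simp [hi, Λ.lattice.zero_mem]
  · rw [Finset.sum_eq_single (0 : Fin e) (fun i _ hi ↦ by simp [hi]) (by simp)]
    simp

/-- **Edixhoven's jump filtration** `F_j L := L ∩ ϖ^{−j} L_K = {g ∈ L : ϖ^j g ∈ L_K}`
(`j = 0, 1, …`; increasing, `F_{e−1} L = L`): the cotangent-side reading of Edixhoven's filtration
of `𝒥 ⊗ k` by the closed subgroups `F^i` (Halle–Nicaise II §1.3): `dim_{𝔽_p} F_j L/F_{j−1} L mod p`
is the multiplicity of the `K(e)`-jump `j`, i.e. of the jump `j/e`.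
[cite: HalleNicaise2016, Part II §1.3] -/
def jumpFiltration (j : ℕ) : Submodule ℤ (CuspForm (Gamma0 N) 2) where
  carrier := {g | g ∈ Λ.lattice ∧ tameUnif p e ^ j • g ∈ Λ.latticeK}
  zero_mem' := ⟨Λ.lattice.zero_mem, by rw [smul_zero]; exact Λ.latticeK.zero_mem⟩
  add_mem' := by
    rintro a b ⟨ha, ha'⟩ ⟨hb, hb'⟩
    exact ⟨Λ.lattice.add_mem ha hb, by rw [smul_add]; exact Λ.latticeK.add_mem ha' hb'⟩
  smul_mem' := by
    rintro z a ⟨ha, ha'⟩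
    exact ⟨Λ.lattice.smul_mem z ha, by rw [smul_comm]; exact Λ.latticeK.smul_mem z ha'⟩

/-- Membership in `F_j L` (unfolding). [cite: HalleNicaise2016, Part II §1.3] -/
theorem mem_jumpFiltration {j : ℕ} {g : CuspForm (Gamma0 N) 2} :
    g ∈ Λ.jumpFiltration j ↔ g ∈ Λ.lattice ∧ tameUnif p e ^ j • g ∈ Λ.latticeK :=
  Iff.rfl

/-- `F_j L ⊆ L`. [cite: HalleNicaise2016, Part II §1.3] -/
theorem jumpFiltration_le_lattice (j : ℕ) : Λ.jumpFiltration j ≤ Λ.lattice :=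
  fun _ hg ↦ hg.1

/-- The filtration is increasing: `F_j L ⊆ F_{j'} L` for `j ≤ j'` (`L_K` is `ϖ`-stable).
[cite: HalleNicaise2016, Part II §1.3] -/
theorem jumpFiltration_mono {j j' : ℕ} (hjj' : j ≤ j') : Λ.jumpFiltration j ≤ Λ.jumpFiltration j' := by
  rintro g ⟨hg, hg'⟩
  refine ⟨hg, ?_⟩
  rw [← Nat.add_sub_cancel' hjj', pow_add, mul_comm, mul_smul]
  exact Λ.tameUnif_pow_smul_memK hg' _

/-- `F_{e−1} L = L`: all jumps are `< 1` (Edixhoven's bound, field `pow_smul_memK`).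
[cite: HalleNicaise2016, Part II §1.3] -/
theorem jumpFiltration_pred_eq : Λ.jumpFiltration (e - 1) = Λ.lattice :=
  le_antisymm (Λ.jumpFiltration_le_lattice _) fun g hg ↦ ⟨hg, Λ.pow_smul_memK g hg⟩

/-- `F_0 L = L ∩ L_K`. [cite: HalleNicaise2016, Part II §1.3] -/
theorem jumpFiltration_zero : Λ.jumpFiltration 0 = Λ.lattice ⊓ Λ.latticeK := by
  ext g
  rw [mem_jumpFiltration, pow_zero, one_smul, Submodule.mem_inf]

open Classical in
/-- **The jump degree `jdeg(g)`** of `g ∈ L`: the least `j` with `ϖ^j g ∈ L_K` (exists: `j = e−1`).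
For the newform `f` of an optimal datum this is the position of `f` in Edixhoven's filtration,
`jdeg(f) = min {j : f ∈ F_j L}`, the quantity `jdeg(W)` of LINE 38. [cite: HalleNicaise2016, Part II §1.3] -/
def jdeg {g : CuspForm (Gamma0 N) 2} (hg : g ∈ Λ.lattice) : ℕ :=
  Nat.find (Λ.exists_pow_smul_memK hg)

open Classical in
/-- `ϖ^{jdeg g} g ∈ L_K`. [cite: HalleNicaise2016, Part II §1.3] -/
theorem jdeg_spec {g : CuspForm (Gamma0 N) 2} (hg : g ∈ Λ.lattice) :
    tameUnif p e ^ Λ.jdeg hg • g ∈ Λ.latticeK :=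
  Nat.find_spec (Λ.exists_pow_smul_memK hg)

open Classical in
/-- Minimality: `ϖ^j g ∈ L_K ⇒ jdeg g ≤ j`. [cite: HalleNicaise2016, Part II §1.3] -/
theorem jdeg_le_of_mem {g : CuspForm (Gamma0 N) 2} (hg : g ∈ Λ.lattice) {j : ℕ}
    (hj : tameUnif p e ^ j • g ∈ Λ.latticeK) : Λ.jdeg hg ≤ j :=
  Nat.find_min' _ hj

/-- `jdeg g ≤ e − 1` (Edixhoven's bound). [cite: HalleNicaise2016, Part II §1.3] -/
theorem jdeg_le {g : CuspForm (Gamma0 N) 2} (hg : g ∈ Λ.lattice) : Λ.jdeg hg ≤ e - 1 :=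
  Λ.jdeg_le_of_mem hg (Λ.pow_smul_memK g hg)

/-- `ϖ^j g ∈ L_K` for every `j ≥ jdeg g`. [cite: HalleNicaise2016, Part II §1.3] -/
theorem pow_smul_memK_of_jdeg_le {g : CuspForm (Gamma0 N) 2} (hg : g ∈ Λ.lattice) {j : ℕ}
    (hj : Λ.jdeg hg ≤ j) : tameUnif p e ^ j • g ∈ Λ.latticeK := by
  rw [← Nat.add_sub_cancel' hj, pow_add, mul_comm, mul_smul]
  exact Λ.tameUnif_pow_smul_memK (Λ.jdeg_spec hg) _

/-- `g ∈ F_j L ⟺ jdeg g ≤ j` for `g ∈ L`: `jdeg` is the position of `g` in the jump filtration.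
[cite: HalleNicaise2016, Part II §1.3] -/
theorem mem_jumpFiltration_iff_jdeg_le {g : CuspForm (Gamma0 N) 2} (hg : g ∈ Λ.lattice) (j : ℕ) :
    g ∈ Λ.jumpFiltration j ↔ Λ.jdeg hg ≤ j :=
  ⟨fun h ↦ Λ.jdeg_le_of_mem hg h.2, fun h ↦ ⟨hg, Λ.pow_smul_memK_of_jdeg_le hg h⟩⟩

/-- `x ∈ ϖ^m L_K` (with an explicit witness): the currency in which the `O_K`-length of
`coker(Lie 𝒥_K → Lie ℰ_K)` is read on cotangent spaces (Halle–Nicaise: elementary divisors and the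
length of the cokernel of a morphism of free modules over a discrete valuation ring).
[cite: HalleNicaise2016, Part II §1.1 (elementary divisors, `c(f) = length coker f`)] -/
def InPowK (x : CuspForm (Gamma0 N) 2) (m : ℕ) : Prop :=
  ∃ y ∈ Λ.latticeK, x = tameUnif p e ^ m • y

/-- `x ∈ ϖ^0 L_K ⟺ x ∈ L_K`. [cite: HalleNicaise2016, Part II §1.1] -/
theorem inPowK_zero_iff (x : CuspForm (Gamma0 N) 2) : Λ.InPowK x 0 ↔ x ∈ Λ.latticeK := by
  constructor
  · rintro ⟨y, hy, rfl⟩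
    simpa using hy
  · exact fun hx ↦ ⟨x, hx, by simp⟩

/-- `ϖ^{m'} L_K ⊇ ϖ^m L_K` for `m' ≤ m`. [cite: HalleNicaise2016, Part II §1.1] -/
theorem InPowK.of_le {x : CuspForm (Gamma0 N) 2} {m m' : ℕ} (hle : m' ≤ m) (h : Λ.InPowK x m) :
    Λ.InPowK x m' := by
  obtain ⟨y, hy, rfl⟩ := h
  refine ⟨tameUnif p e ^ (m - m') • y, Λ.tameUnif_pow_smul_memK hy _, ?_⟩
  rw [← mul_smul, ← pow_add, Nat.add_sub_cancel' hle]

/-- **The tame colength of a datum**, `col_K(D, a) := sup {m : ϖ^a·c·f ∈ ϖ^m L_K}` (`ℕ`-valued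
`sSup`; junk value `0` if the set were unbounded — it is bounded as soon as `f ∉ ϖ O_K L`, companion
`…TameProofs`). DICTIONARY: when `a` is the Néron exponent of `W` over `K` (`HasTameGoodModel p e W a`,
`ω_{W,K} = ϖ^a ω_W`), `ϖ^a c f = π^* ω_{W,K}` and `col_K(D, a) = length_{O_K} coker(Lie 𝒥_K → Lie ℰ_K)`,
the `K`-inseparability colength of LINE 38 (`= 0` iff `𝒥_K → ℰ_K` is smooth, i.e. `φ` is
"Lie-surjective over `O_K`"). [folklore] -/
def tameColength {W : WeierstrassCurve ℚ} (D : ModularParametrizationData W N) (a : ℕ) : ℕ :=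
  sSup {m : ℕ | Λ.InPowK ((tameUnif p e ^ a * (D.maninConstant : ℂ)) • D.f) m}

/-- Under `HasTameGoodModel p e W a` (and lattice-optimality), `ϖ^a c f ∈ L_K = ϖ^0 L_K`: the set
defining `tameColength` is non-empty (field `tame_smul_memK`).
[cite: BoschLutkebohmertRaynaud1990, Def. 1.2/1] -/
theorem inPowK_zero_of_hasTameGoodModel {W : WeierstrassCurve ℚ} [W.IsElliptic]
    [W.IsGloballyMinimal] (D : ModularParametrizationData W N)
    (hopt : ∀ z ∈ D.L.lattice, ∃ w ∈ periodLattice D.f, z = D.c * w) {a : ℕ}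
    (ha : HasTameGoodModel p e W a) :
    Λ.InPowK ((tameUnif p e ^ a * (D.maninConstant : ℂ)) • D.f) 0 :=
  (Λ.inPowK_zero_iff _).2 (Λ.tame_smul_memK W D hopt a ha)

include Λ in
/-- The `R`-level pull-back integrality at `g = f` reads `deg φ·⟨f, f⟩ = t·c·⟨f, f⟩` with `t ∈ ℤ_(p)` —
the displayed hypothesis from which `v_p(c) ≤ v_p(deg φ)` follows once `⟨f, f⟩ ≠ 0` (ČNS Thm. 7.2 at
`p`; the deduction is in the companion file). [cite: CesnaviciusNeururerSaha2023, Thm. 7.2 (p. 47)] -/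
theorem pullback_integral_self {W : WeierstrassCurve ℚ} [W.IsElliptic] [W.IsGloballyMinimal]
    (D : ModularParametrizationData W N)
    (hopt : ∀ z ∈ D.L.lattice, ∃ w ∈ periodLattice D.f, z = D.c * w) :
    ∃ t : ℚ, 0 ≤ padicValRat p t ∧
      (D.modularDegree : ℂ) * peterssonProduct (Gamma0 N) 2 D.f D.f =
        (t : ℂ) * (D.maninConstant : ℂ) * peterssonProduct (Gamma0 N) 2 D.f D.f :=
  Λ.pullback_integral W D hopt D.f (Λ.f_mem D)

end TameNeronFormsAt

end Literature.NumberTheory.EllipticCurves.ModularForms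

end
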